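import Summits.HodgeConjecture.CorCM.MultiFieldWeilThreePerFieldFamilies
import Summits.HodgeConjecture.CorCM.MultiFieldWeilQuadraticSexticClosures
import HarnessLib

/-!
# MULTI-FIELD WEIL ENGINE — THE CLASSES-PER-FIELD FAMILY THEOREM: simple CM abelian varieties of dimension `≤ 3` with at most ONE threefold per sextic CM field having an
# imaginary quadratic subfield, at most THREE non-isogenous threefolds per sextic CM field having none, and no dihedral surface triple — the Hodge conjecture for every
# product of copies, given ONLY Markman's fourfold theorem

Cell `pub-hodgecm2` (COR-CM), seat b30 gen 37 (2026-08-25); count-neutral own lane MULTI-FIELD WEIL ENGINE (stem `MultiFieldWeil*`).  Theorems only; no definition, no named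
fact, no `sorry`.  HONEST FRAMING: conditional ONLY on `Markman2025_weilClasses_algebraic_abelianFourfold`; `HC_CM` is NOT proved and not asserted.

This is `CorCM/MultiFieldWeilThreePerFieldFamilies.lean` with its hypothesis (A′) «two sextic slots SHARING an imaginary quadratic field have DIFFERENT Galois closures» replaced,
through the 𝔖₃ lemma (`CorCM/MultiFieldWeilQuadraticSexticClosures.lean`: sharing + one closure ⟹ isomorphic), by (A) «… have NON-ISOMORPHIC fields» — and then read per
isomorphism class of fields.  **`hodgeConjectureFor_prod_of_sharedNonIsomorphic_threePerField_of_markman`**: `A_i ⊨ (K_i; Φ_i)` (`i ∈ I` finite) SIMPLE of dimension `≤ 3`, sextic slots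
pairwise non-isogenous, (A) two sextic slots sharing an imaginary quadratic field have non-isomorphic fields, (B″) at most THREE sextic slots per isomorphism class of fields,
(iii′) among three quartic slots with one closure two carry isogenous surfaces ⟹ HC for EVERY product of copies `⨁_j A_{π j}`.  **`hodgeConjectureFor_prod_of_classesPerField_of_markman`**
(THE CLASSES-PER-FIELD FORM): (A) is implied by (A₁) «a sextic slot whose field has a totally complex quadratic subfield shares its isomorphism class of fields with NO other sextic
slot» — so the sextic hypotheses read: per isomorphism class of sextic CM fields, at most ONE slot if the field HAS an imaginary quadratic subfield, at most THREE if it has NONE.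
Compare seat b16's UNCONDITIONAL census (`CorCM/SimpleCMProductsDimLeThreeHodge`, `CorCM/CMAbelianFactorsDimLeThreeClassification`): (i′) NO imaginary quadratic field shared by two
slots (curves included), (ii′) at most three per field, (iii′); here (i′) is relaxed EXACTLY to (A₁) — CM elliptic curves and threefolds over pairwise non-isomorphic fields may share
imaginary quadratic fields freely (the Weil-type world) — at the price of Markman's theorem.  HONEST LIMITS: two or three non-isogenous threefolds over ONE field `k·F⁺` (three carry
an exceptional class not of Weil type; a single pair with curves is `CorCM/MultiFieldWeilAnyTwoSimpleThreefoldsAnyCurves`); four classes of one field; the dihedral surface triple;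
simple factors of dimension `≥ 4`.
[cite: MoonenZarhin1999LowDim, Thm. (0.1), Thm. (0.2), §3 (3.1), Cor. (3.9)] [cite: Markman2025SurveySecant, Thm. 1.2] [cite: Dodson1984, §5.1.2 Theorem]
[cite: Gordon1999HodgeAVSurvey, §3 Theorem (proof), 7.4–7.7, 9.4] [cite: Lang2002, I §6 Thm. 6.4 (ii); VI §1 Thm. 1.1] [cite: MumfordAV1970, §19]

## References
* [MoonenZarhin1999LowDim] B. Moonen, Yu. Zarhin, Math. Ann. 315 (1999).  [Markman2025SurveySecant] E. Markman, arXiv:2509.23403.  [Dodson1984] B. Dodson, Trans. AMS 283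
  (1984).  [Gordon1999HodgeAVSurvey] B. B. Gordon, survey.  [Lang2002] S. Lang, *Algebra*, I §6, VI §1.  [MumfordAV1970] D. Mumford, *Abelian Varieties*, §19.
-/

noncomputable section

open CategoryTheory CategoryTheory.Limits NumberField IntermediateField

namespace Summit.HodgeConjecture.CorCM.MultiFieldWeil

open Literature.NumberTheory.ComplexMultiplication
open Literature.AlgebraicGeometry Literature.AlgebraicGeometry.Motives Literature.AlgebraicGeometry.HodgeTheory
open Literature.AlgebraicGeometry.ComplexMultiplication (IsCMTypeRealisation)
open Literature.AlgebraicTopology.SingularHomology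

open scoped Classical

variable {I : Type} {K : I → Type} [∀ i, Field (K i)] [∀ i, NumberField (K i)] [∀ i, IsCMField (K i)]
  {Φ : ∀ i, CMType (K i)} {A : I → AbelianVariety ℂ} {ι : ∀ i, 𝓞 (K i) →+* End (A i)} {θ : ∀ i, K i →+* Module.End ℂ (complexBetti (A i).X 1)}

/-! ## §1 Sharing ⟹ non-isomorphic -/

/-- **MAIN THEOREM — SHARING ⟹ NON-ISOMORPHIC, THREE PER FIELD.**  `A_i ⊨ (K_i; Φ_i)` (`i ∈ I` finite) SIMPLE of dimension `≤ 3`, sextic slots pairwise non-isogenous, such that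
(A) two distinct sextic slots whose fields share an imaginary quadratic field have NON-ISOMORPHIC fields, (B″) at most three sextic slots have fields isomorphic to a given one,
(iii′) among three quartic slots with one Galois closure two carry isogenous surfaces.  Then the Hodge conjecture holds for EVERY product of copies `⨁_j A_{π j}`, GIVEN ONLY
Markman's fourfold theorem ((A) gives (A′) «different closures» by the 𝔖₃ lemma).  `HC_CM` is NOT asserted. [cite: MoonenZarhin1999LowDim, Thm. (0.1), Thm. (0.2), §3 (3.1), Cor. (3.9)]
[cite: Markman2025SurveySecant, Thm. 1.2] [cite: Lang2002, I §6 Thm. 6.4 (ii); VI §1 Thm. 1.1] [cite: Dodson1984, §5.1.2 Theorem] -/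
theorem hodgeConjectureFor_prod_of_sharedNonIsomorphic_threePerField_of_markman [Fintype I] (hW4 : Markman2025_weilClasses_algebraic_abelianFourfold)
    (hA : ∀ i, IsCMTypeRealisation (Φ i) (A i) (ι i) (θ i)) (hS : ∀ i, (A i).IsSimple) (h3 : ∀ i, (A i).dim ≤ 3)
    (hQ : ∀ t t' : I, t ≠ t' → Module.finrank ℚ (K t) = 6 → Module.finrank ℚ (K t') = 6 →
      (∃ F : IntermediateField ℚ (K t), Module.finrank ℚ F = 2 ∧ IsTotallyComplex F ∧ Nonempty (F →+* K t')) → IsEmpty (K t' ≃+* K t))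
    (hN : ∀ t t' : I, t ≠ t' → Module.finrank ℚ (K t) = 6 → Module.finrank ℚ (K t') = 6 → ¬ AbelianVariety.IsIsogenous (A t) (A t'))
    (hB3 : ∀ t : I, Module.finrank ℚ (K t) = 6 → (Finset.univ.filter fun t' => Nonempty (K t' ≃+* K t)).card ≤ 3)
    (hS3 : ∀ x y z : I, Module.finrank ℚ (K x) = 4 → Module.finrank ℚ (K y) = 4 → Module.finrank ℚ (K z) = 4 →
      normalClosure ℚ (K x) ℂ = normalClosure ℚ (K y) ℂ → normalClosure ℚ (K y) ℂ = normalClosure ℚ (K z) ℂ →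
      AbelianVariety.IsIsogenous (A x) (A y) ∨ AbelianVariety.IsIsogenous (A x) (A z) ∨ AbelianVariety.IsIsogenous (A y) (A z))
    {N : ℕ} (π : Fin N → I) : HodgeConjectureFor (⨁ fun j => A (π j)).dim (⨁ fun j => A (π j)).X :=
  hodgeConjectureFor_prod_of_threePerField_of_markman hW4 hA hS h3
    (fun t t' hne ht ht' hsh => normalClosure_ne_of_sharedQuadratic_of_isEmpty_ringEquiv ht ht' hsh (hQ t t' hne ht ht' hsh)) hN hB3 hS3 π

/-- **«`Hom = ∅`» form of (A)** (as in `CorCM/MultiFieldWeilNoClosureTripleFactors.lean`): sharing ⟹ `Hom(K_t, K_{t'}) = ∅`. [cite: MoonenZarhin1999LowDim, Thm. (0.1), Thm. (0.2)]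
[cite: Markman2025SurveySecant, Thm. 1.2] [cite: Lang2002, I §6 Thm. 6.4 (ii); VI §1 Thm. 1.1] -/
theorem hodgeConjectureFor_prod_of_sharedIsEmptyRingHom_threePerField_of_markman [Fintype I] (hW4 : Markman2025_weilClasses_algebraic_abelianFourfold)
    (hA : ∀ i, IsCMTypeRealisation (Φ i) (A i) (ι i) (θ i)) (hS : ∀ i, (A i).IsSimple) (h3 : ∀ i, (A i).dim ≤ 3)
    (hQ : ∀ t t' : I, t ≠ t' → Module.finrank ℚ (K t) = 6 → Module.finrank ℚ (K t') = 6 →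
      (∃ F : IntermediateField ℚ (K t), Module.finrank ℚ F = 2 ∧ IsTotallyComplex F ∧ Nonempty (F →+* K t')) → IsEmpty (K t →+* K t'))
    (hN : ∀ t t' : I, t ≠ t' → Module.finrank ℚ (K t) = 6 → Module.finrank ℚ (K t') = 6 → ¬ AbelianVariety.IsIsogenous (A t) (A t'))
    (hB3 : ∀ t : I, Module.finrank ℚ (K t) = 6 → (Finset.univ.filter fun t' => Nonempty (K t' ≃+* K t)).card ≤ 3)
    (hS3 : ∀ x y z : I, Module.finrank ℚ (K x) = 4 → Module.finrank ℚ (K y) = 4 → Module.finrank ℚ (K z) = 4 →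
      normalClosure ℚ (K x) ℂ = normalClosure ℚ (K y) ℂ → normalClosure ℚ (K y) ℂ = normalClosure ℚ (K z) ℂ →
      AbelianVariety.IsIsogenous (A x) (A y) ∨ AbelianVariety.IsIsogenous (A x) (A z) ∨ AbelianVariety.IsIsogenous (A y) (A z))
    {N : ℕ} (π : Fin N → I) : HodgeConjectureFor (⨁ fun j => A (π j)).dim (⨁ fun j => A (π j)).X :=
  hodgeConjectureFor_prod_of_threePerField_of_markman hW4 hA hS h3
    (fun t t' hne ht ht' hsh => normalClosure_ne_of_sharedQuadratic_of_isEmpty_ringHom ht ht' hsh (hQ t t' hne ht ht' hsh)) hN hB3 hS3 π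

/-! ## §2 The classes-per-field form -/

omit [∀ i, NumberField (K i)] [∀ i, IsCMField (K i)] in
/-- (A₁) «a has-k sextic slot is alone in its isomorphism class» implies (A) «sharing ⟹ non-isomorphic». [cite: Lang2002, VI §1 Thm. 1.1] -/
theorem sharedQuadratic_isEmpty_of_classesPerField [∀ i, NumberField (K i)]
    (hB1 : ∀ t t' : I, t ≠ t' → Module.finrank ℚ (K t) = 6 → Module.finrank ℚ (K t') = 6 →
      (∃ F : IntermediateField ℚ (K t), Module.finrank ℚ F = 2 ∧ IsTotallyComplex F) → IsEmpty (K t' ≃+* K t))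
    (t t' : I) (hne : t ≠ t') (ht : Module.finrank ℚ (K t) = 6) (ht' : Module.finrank ℚ (K t') = 6)
    (hsh : ∃ F : IntermediateField ℚ (K t), Module.finrank ℚ F = 2 ∧ IsTotallyComplex F ∧ Nonempty (F →+* K t')) : IsEmpty (K t' ≃+* K t) := by
  obtain ⟨F, hF2, hFtc, -⟩ := hsh
  exact hB1 t t' hne ht ht' ⟨F, hF2, hFtc⟩

/-- **MAIN THEOREM — CLASSES PER FIELD.**  `A_i ⊨ (K_i; Φ_i)` (`i ∈ I` finite) SIMPLE of dimension `≤ 3`, sextic slots pairwise non-isogenous, such that (A₁) a sextic slot whose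
field has a totally complex quadratic subfield shares its isomorphism class of fields with NO other sextic slot, (B″) at most THREE sextic slots have fields isomorphic to a given one,
(iii′) among three quartic slots with one Galois closure two carry isogenous surfaces — i.e. per isomorphism class of sextic CM fields at most ONE slot when the field has an
imaginary quadratic subfield and at most THREE when it has none.  Then the Hodge conjecture holds for EVERY product of copies `⨁_j A_{π j}`, GIVEN ONLY Markman's fourfold
theorem.  CM elliptic curves and threefolds over pairwise NON-ISOMORPHIC sextic fields may share imaginary quadratic fields freely.  `HC_CM` is NOT asserted.
[cite: MoonenZarhin1999LowDim, Thm. (0.1), Thm. (0.2), §3 (3.1), Cor. (3.9)] [cite: Markman2025SurveySecant, Thm. 1.2] [cite: Lang2002, I §6 Thm. 6.4 (ii); VI §1 Thm. 1.1]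
[cite: Dodson1984, §5.1.2 Theorem] [cite: Gordon1999HodgeAVSurvey, §3 Theorem (proof), 7.4–7.7, 9.4] -/
theorem hodgeConjectureFor_prod_of_classesPerField_of_markman [Fintype I] (hW4 : Markman2025_weilClasses_algebraic_abelianFourfold)
    (hA : ∀ i, IsCMTypeRealisation (Φ i) (A i) (ι i) (θ i)) (hS : ∀ i, (A i).IsSimple) (h3 : ∀ i, (A i).dim ≤ 3)
    (hB1 : ∀ t t' : I, t ≠ t' → Module.finrank ℚ (K t) = 6 → Module.finrank ℚ (K t') = 6 →
      (∃ F : IntermediateField ℚ (K t), Module.finrank ℚ F = 2 ∧ IsTotallyComplex F) → IsEmpty (K t' ≃+* K t))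
    (hN : ∀ t t' : I, t ≠ t' → Module.finrank ℚ (K t) = 6 → Module.finrank ℚ (K t') = 6 → ¬ AbelianVariety.IsIsogenous (A t) (A t'))
    (hB3 : ∀ t : I, Module.finrank ℚ (K t) = 6 → (Finset.univ.filter fun t' => Nonempty (K t' ≃+* K t)).card ≤ 3)
    (hS3 : ∀ x y z : I, Module.finrank ℚ (K x) = 4 → Module.finrank ℚ (K y) = 4 → Module.finrank ℚ (K z) = 4 →
      normalClosure ℚ (K x) ℂ = normalClosure ℚ (K y) ℂ → normalClosure ℚ (K y) ℂ = normalClosure ℚ (K z) ℂ →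
      AbelianVariety.IsIsogenous (A x) (A y) ∨ AbelianVariety.IsIsogenous (A x) (A z) ∨ AbelianVariety.IsIsogenous (A y) (A z))
    {N : ℕ} (π : Fin N → I) : HodgeConjectureFor (⨁ fun j => A (π j)).dim (⨁ fun j => A (π j)).X :=
  hodgeConjectureFor_prod_of_sharedNonIsomorphic_threePerField_of_markman hW4 hA hS h3 (sharedQuadratic_isEmpty_of_classesPerField hB1) hN hB3 hS3 π

/-- **Dominated form** (everything dominated by a product of copies: isogeny factors, quotients, abelian subvarieties). [cite: MoonenZarhin1999LowDim, Thm. (0.1), (0.2)]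
[cite: Markman2025SurveySecant, Thm. 1.2] [cite: MumfordAV1970, §19 Thm. 1 and p. 169] -/
theorem hodgeConjectureFor_of_avDominatedBy_prod_of_classesPerField_of_markman [Fintype I] (hW4 : Markman2025_weilClasses_algebraic_abelianFourfold)
    (hA : ∀ i, IsCMTypeRealisation (Φ i) (A i) (ι i) (θ i)) (hS : ∀ i, (A i).IsSimple) (h3 : ∀ i, (A i).dim ≤ 3)
    (hB1 : ∀ t t' : I, t ≠ t' → Module.finrank ℚ (K t) = 6 → Module.finrank ℚ (K t') = 6 →
      (∃ F : IntermediateField ℚ (K t), Module.finrank ℚ F = 2 ∧ IsTotallyComplex F) → IsEmpty (K t' ≃+* K t))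
    (hN : ∀ t t' : I, t ≠ t' → Module.finrank ℚ (K t) = 6 → Module.finrank ℚ (K t') = 6 → ¬ AbelianVariety.IsIsogenous (A t) (A t'))
    (hB3 : ∀ t : I, Module.finrank ℚ (K t) = 6 → (Finset.univ.filter fun t' => Nonempty (K t' ≃+* K t)).card ≤ 3)
    (hS3 : ∀ x y z : I, Module.finrank ℚ (K x) = 4 → Module.finrank ℚ (K y) = 4 → Module.finrank ℚ (K z) = 4 →
      normalClosure ℚ (K x) ℂ = normalClosure ℚ (K y) ℂ → normalClosure ℚ (K y) ℂ = normalClosure ℚ (K z) ℂ →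
      AbelianVariety.IsIsogenous (A x) (A y) ∨ AbelianVariety.IsIsogenous (A x) (A z) ∨ AbelianVariety.IsIsogenous (A y) (A z))
    {N : ℕ} (π : Fin N → I) {X : AbelianVariety ℂ} (hX : Domination.AVDominatedBy X (⨁ fun j => A (π j))) : HodgeConjectureFor X.dim X.X :=
  Domination.hodgeConjectureFor_of_avDominatedBy (hodgeConjectureFor_prod_of_classesPerField_of_markman hW4 hA hS h3 hB1 hN hB3 hS3 π) hX

/-! ## §3 Simple threefolds only: no surface hypothesis -/

/-- **Simple CM THREEFOLDS only** (and CM elliptic curves): pairwise non-isogenous threefold slots with (A₁) and (B″) ⟹ HC for every product of copies, given only Markman's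
fourfold theorem ((iii′) is vacuous without quartic slots). [cite: MoonenZarhin1999LowDim, Thm. (0.1), §3 (3.1)] [cite: Markman2025SurveySecant, Thm. 1.2]
[cite: Lang2002, I §6 Thm. 6.4 (ii); VI §1 Thm. 1.1] -/
theorem hodgeConjectureFor_prod_of_classesPerField_of_ne_four_of_markman [Fintype I] (hW4 : Markman2025_weilClasses_algebraic_abelianFourfold)
    (hA : ∀ i, IsCMTypeRealisation (Φ i) (A i) (ι i) (θ i)) (hS : ∀ i, (A i).IsSimple) (h3 : ∀ i, (A i).dim ≤ 3) (h2 : ∀ i, (A i).dim ≠ 2)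
    (hB1 : ∀ t t' : I, t ≠ t' → Module.finrank ℚ (K t) = 6 → Module.finrank ℚ (K t') = 6 →
      (∃ F : IntermediateField ℚ (K t), Module.finrank ℚ F = 2 ∧ IsTotallyComplex F) → IsEmpty (K t' ≃+* K t))
    (hN : ∀ t t' : I, t ≠ t' → Module.finrank ℚ (K t) = 6 → Module.finrank ℚ (K t') = 6 → ¬ AbelianVariety.IsIsogenous (A t) (A t'))
    (hB3 : ∀ t : I, Module.finrank ℚ (K t) = 6 → (Finset.univ.filter fun t' => Nonempty (K t' ≃+* K t)).card ≤ 3)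
    {N : ℕ} (π : Fin N → I) : HodgeConjectureFor (⨁ fun j => A (π j)).dim (⨁ fun j => A (π j)).X :=
  hodgeConjectureFor_prod_of_classesPerField_of_markman hW4 hA hS h3 hB1 hN hB3
    (fun x _ _ hx _ _ _ _ => absurd (by have := Literature.AlgebraicGeometry.Pohlmann1968.finrank_eq_two_mul_dim_of_isCMTypeRealisation (hA x); omega) (h2 x)) π

end Summit.HodgeConjecture.CorCM.MultiFieldWeil

end
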